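import Summits.ResolutionOfSingularities.ResolutionOfSingularities.Theorems.RadicialJungCleanModelsGiraudExactness
import Summits.ResolutionOfSingularities.ResolutionOfSingularities.Theorems.RadicialJungCleanModelsGiraudLogJacobianStructure
import HarnessLib

/-!
# Route `RadicialJung`, crux `CleanModels` (stmt-15917): the data `(a, D₀, B)` of a non-crossing
# Giraud-singular point — `J = xᵃ(D₀ + (B))`, `D(J) = D₀ + (B)`, `D₀ ⊆ xR + 𝔪²` (Giraud 1983, 2.5–2.6)

Support file (OURS) for PROGRAMME-clean-dim2 / T2 (`stub_step`, bricks B4/B5), line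
`via-clean-models` of the crux `DescentPerfectToAll` (stmt-0549). Nothing here is a statement of
Hironaka's manuscript.

Giraud (Bull. SMF 111 (1983), 2.5): at a point of `Sing(X, ω)` with `E(ω) = div(x)`,
"`ω = xᵃ(A dx/x + B dy + Σ C_ν du_ν)` où `A, B` et les `C_ν` sont premiers entre eux dans leur
ensemble, ce qui s'écrit également `D(J) = (A, B, C_ν)R`"; on the chart of `x` the transform has
`J′ = xᵃ(A, xB, C_ν)·𝒪′` (the tree's (C2), `RadicialJungCleanModelsLogContentIdealBlowup.lean`:
`J(T, f; log x) = (x∂_x f, x∂_y f)T + N T`), on the other chart `J′ = xᵃ(A, yB, C_ν)·𝒪″` ((C1):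
`J(T, f; log y, log x/y) = J(R, f; log x, log y)·T`); and 2.6 gives `(A, C_ν) ⊆ xR + 𝔪²` for
`ω = df`. Here, for a local domain `R` of characteristic `p` with `𝔪 = (x, y)`, `x` prime,
`x ≠ y`, a `p`-basis `Γ ∋ x, y` with dual derivations `δ` and `f ∈ R`, writing
`N = (δ_u f : u ∈ Γ ∖ {x, y})` and `J = (x δ_x f, δ_y f) + N` (`= J(R, f; log x)`,
`RadicialJungCleanModelsPBasisLogContentSpan.lean`), under `B(J) = (xᵃ)`
(`RadicialJungCleanModelsGiraudLogJacobianStructure.lean`) and `D(J) ⊆ 𝔪` (`c ≠ 0`):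

* `exists_nonCrossing_data` — **there are an ideal `D₀` (Giraud's `(A, C_ν)`) and an element `B`
  with `(x δ_x f) + N = xᵃ·D₀`, `δ_y f = xᵃ B`, `D(J) = D₀ + (B)`,
  `(x δ_x f, x δ_y f) + N = xᵃ·(D₀ + (xB))` (the (C2) right-hand side),
  `(x δ_x f, y δ_y f) + N = xᵃ·(D₀ + (yB))` (the (C1) right-hand side `J(R, f; log x, log y)`),
  `D₀ + (B) ⊆ 𝔪`, and `D₀ ⊆ xR + 𝔪²`** (`giraud_exactness`) — exactly the hypotheses
  `hJ'`/`hex` of `colength_nonCrossing_chart` / `colength_le_of_nonCrossing_oppositeChart`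
  (`RadicialJungCleanModelsGiraudStepColength.lean`).

References: J. Giraud, Bull. SMF 111 (1983), 2.5, 2.6 [Giraud1983].
-/

noncomputable section

set_option linter.dupNamespace false -- mandated namespace of this single-conjunct summit

open IsLocalRing Literature.RingTheory.PBasis Literature.AlgebraicGeometry.Resolution

namespace Summit.ResolutionOfSingularities.ResolutionOfSingularities.Theorems.RadicialJung.CleanModels

universe u

section Division

variable {R : Type u} [CommRing R]

/-- Dividing a set of multiples of `d` by `d`: `(S) = (d)·(S/d)`. [folklore] -/
theorem span_eq_span_singleton_mul_span_image {d : R} {S : Set R} (q : R → R)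
    (hq : ∀ s ∈ S, d * q s = s) : Ideal.span S = Ideal.span {d} * Ideal.span (q '' S) := by
  apply le_antisymm
  · rw [Ideal.span_le]
    intro s hs
    rw [SetLike.mem_coe, ← hq s hs]
    exact Ideal.mul_mem_mul (Ideal.mem_span_singleton_self d) (Ideal.subset_span ⟨s, hs, rfl⟩)
  · rw [Ideal.span_mul_span, Ideal.span_le]
    rintro _ ⟨a, ha, b, hb, rfl⟩
    rw [Set.mem_singleton_iff] at ha
    obtain ⟨s, hs, rfl⟩ := hb
    subst ha
    show a * q s ∈ Ideal.span S
    rw [hq s hs]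
    exact Ideal.subset_span hs

/-- `(d)·I ⊔ (d)·I′ = (d)·(I ⊔ I′)`. [folklore] -/
theorem span_singleton_mul_sup (d : R) (I I' : Ideal R) :
    Ideal.span {d} * I ⊔ Ideal.span {d} * I' = Ideal.span {d} * (I ⊔ I') :=
  (Ideal.mul_sup _ _ _).symm

end Division

section Data

variable {p : ℕ} [Fact p.Prime] {R : Type u} [CommRing R] [CharP R p] [IsDomain R] [IsLocalRing R]
  {Γ : Set R} (δ : Γ → Derivation ℤ R R) (hδ₁ : ∀ γ : Γ, δ γ (γ : R) = 1)
  (hδ₀ : ∀ γ γ' : Γ, γ' ≠ γ → δ γ (γ' : R) = 0)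
  {x y : R} (hx : x ∈ Γ) (hy : y ∈ Γ) (hm : maximalIdeal R = Ideal.span {x, y})

include hδ₁ hδ₀ hm in
/-- **The data `(D₀, B)` of a non-crossing Giraud-singular point** (Giraud 1983, 2.5: `D(J) =
(A, B, C_ν)`, `H′`-charts `(A + yB, A, C_ν)`, and 2.6: `(A, C_ν) ⊆ xR + 𝔪²`). Hypotheses: a
`p`-basis `Γ ∋ x, y` with dual derivations, `𝔪 = (x, y)`, `x` prime, and for
`J = (x δ_x f, δ_y f) + (δ_u f : u ∈ Γ ∖ {x, y})`: `B(J) = (xᵃ)` and `D(J) ⊆ 𝔪`.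
[cite: Giraud1983, 2.5–2.6] -/
theorem exists_nonCrossing_data (hΓ : IsPBasisOver p (frobenius R p).range Γ) (hxp : Prime x)
    (f : R) {a : ℕ}
    (hB : principalHullIdeal (Ideal.span ({x * δ ⟨x, hx⟩ f, δ ⟨y, hy⟩ f} ∪
      {v : R | ∃ γ : Γ, (γ : R) ≠ x ∧ (γ : R) ≠ y ∧ δ γ f = v})) = Ideal.span {x ^ a})
    (hc : coprincipalPart (Ideal.span ({x * δ ⟨x, hx⟩ f, δ ⟨y, hy⟩ f} ∪
      {v : R | ∃ γ : Γ, (γ : R) ≠ x ∧ (γ : R) ≠ y ∧ δ γ f = v})) ≤ maximalIdeal R) :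
    ∃ (D₀ : Ideal R) (B : R),
      Ideal.span ({x * δ ⟨x, hx⟩ f} ∪ {v : R | ∃ γ : Γ, (γ : R) ≠ x ∧ (γ : R) ≠ y ∧ δ γ f = v}) =
          Ideal.span {x ^ a} * D₀ ∧
      δ ⟨y, hy⟩ f = x ^ a * B ∧
      coprincipalPart (Ideal.span ({x * δ ⟨x, hx⟩ f, δ ⟨y, hy⟩ f} ∪
          {v : R | ∃ γ : Γ, (γ : R) ≠ x ∧ (γ : R) ≠ y ∧ δ γ f = v})) = D₀ ⊔ Ideal.span {B} ∧
      Ideal.span ({x * δ ⟨x, hx⟩ f, x * δ ⟨y, hy⟩ f} ∪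
          {v : R | ∃ γ : Γ, (γ : R) ≠ x ∧ (γ : R) ≠ y ∧ δ γ f = v}) =
        Ideal.span {x ^ a} * (D₀ ⊔ Ideal.span {x * B}) ∧
      Ideal.span ({x * δ ⟨x, hx⟩ f, y * δ ⟨y, hy⟩ f} ∪
          {v : R | ∃ γ : Γ, (γ : R) ≠ x ∧ (γ : R) ≠ y ∧ δ γ f = v}) =
        Ideal.span {x ^ a} * (D₀ ⊔ Ideal.span {y * B}) ∧
      D₀ ⊔ Ideal.span {B} ≤ maximalIdeal R ∧
      D₀ ≤ Ideal.span {x} ⊔ maximalIdeal R ^ 2 := by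
  classical
  have hxa0 : x ^ a ≠ 0 := pow_ne_zero a hxp.ne_zero
  set Nset : Set R := {v : R | ∃ γ : Γ, (γ : R) ≠ x ∧ (γ : R) ≠ y ∧ δ γ f = v} with hNset
  set J : Ideal R := Ideal.span ({x * δ ⟨x, hx⟩ f, δ ⟨y, hy⟩ f} ∪ Nset) with hJdef
  -- every generator is divisible by `xᵃ`
  have hJle : J ≤ Ideal.span {x ^ a} := hB ▸ le_principalHullIdeal J
  have hdvd : ∀ v ∈ ({x * δ ⟨x, hx⟩ f, δ ⟨y, hy⟩ f} ∪ Nset : Set R), x ^ a ∣ v := fun v hv =>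
    Ideal.mem_span_singleton.mp (hJle (Ideal.subset_span hv))
  -- the quotients
  let q : R → R := fun v => if h : x ^ a ∣ v then Classical.choose h else 0
  have hq : ∀ v, x ^ a ∣ v → x ^ a * q v = v := fun v h => by
    simp only [q, dif_pos h]; exact (Classical.choose_spec h).symm
  set D₀ : Ideal R := Ideal.span (q '' ({x * δ ⟨x, hx⟩ f} ∪ Nset)) with hD₀
  set B : R := q (δ ⟨y, hy⟩ f) with hBdef
  have hqB : x ^ a * B = δ ⟨y, hy⟩ f := hq _ (hdvd _ (Or.inl (Or.inr rfl)))
  have hqx : x ^ a * q (x * δ ⟨x, hx⟩ f) = x * δ ⟨x, hx⟩ f := hq _ (hdvd _ (Or.inl (Or.inl rfl)))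
  have hqN : ∀ v ∈ Nset, x ^ a * q v = v := fun v hv => hq v (hdvd v (Or.inr hv))
  -- (1) `(x δ_x f) + N = xᵃ D₀`
  have h1 : Ideal.span ({x * δ ⟨x, hx⟩ f} ∪ Nset) = Ideal.span {x ^ a} * D₀ :=
    span_eq_span_singleton_mul_span_image q (fun v hv => by
      rcases hv with hv | hv
      · rw [Set.mem_singleton_iff.mp hv]; exact hqx
      · exact hqN v hv)
  -- `J = xᵃ (D₀ + (B))`
  have hJsplit : J = Ideal.span {x ^ a} * (D₀ ⊔ Ideal.span {B}) := by
    have e : ({x * δ ⟨x, hx⟩ f, δ ⟨y, hy⟩ f} ∪ Nset : Set R) =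
        ({x * δ ⟨x, hx⟩ f} ∪ Nset) ∪ {δ ⟨y, hy⟩ f} := by
      ext v; simp only [Set.mem_union, Set.mem_insert_iff, Set.mem_singleton_iff]; tauto
    rw [hJdef, e, Ideal.span_union, h1, ← hqB, ← Ideal.span_singleton_mul_span_singleton,
      span_singleton_mul_sup]
  -- (3) `D(J) = D₀ + (B)`
  have h3 : coprincipalPart J = D₀ ⊔ Ideal.span {B} := by
    ext r
    rw [mem_coprincipalPart_iff_mul_mem hB, hJsplit, mul_mem_span_singleton_mul_iff hxa0]
  -- (4) and (5): the chart right-hand sides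
  have h45 : ∀ z : R, Ideal.span ({x * δ ⟨x, hx⟩ f, z * δ ⟨y, hy⟩ f} ∪ Nset) =
      Ideal.span {x ^ a} * (D₀ ⊔ Ideal.span {z * B}) := by
    intro z
    have e : ({x * δ ⟨x, hx⟩ f, z * δ ⟨y, hy⟩ f} ∪ Nset : Set R) =
        ({x * δ ⟨x, hx⟩ f} ∪ Nset) ∪ {z * δ ⟨y, hy⟩ f} := by
      ext v; simp only [Set.mem_union, Set.mem_insert_iff, Set.mem_singleton_iff]; tauto
    have e2 : z * δ ⟨y, hy⟩ f = x ^ a * (z * B) := by rw [← hqB]; ring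
    rw [e, Ideal.span_union, h1, e2, ← Ideal.span_singleton_mul_span_singleton,
      span_singleton_mul_sup]
  -- (6) `D₀ + (B) ⊆ 𝔪`
  have h6 : D₀ ⊔ Ideal.span {B} ≤ maximalIdeal R := h3 ▸ hc
  -- (7) exactness: `D₀ ⊆ xR + 𝔪²`
  have hJm : J ≤ Ideal.span {x ^ a} * maximalIdeal R :=
    le_span_singleton_mul_of_coprincipalPart_le hB hc
  have hgen : ∀ v ∈ ({x * δ ⟨x, hx⟩ f, δ ⟨y, hy⟩ f} ∪ Nset : Set R),
      v ∈ Ideal.span {x ^ a} * maximalIdeal R := fun v hv => hJm (Ideal.subset_span hv)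
  obtain ⟨Hx, Hγ⟩ := giraud_exactness δ hδ₁ hδ₀ hx hy hm hΓ hxp f a
    (hgen _ (Or.inl (Or.inl rfl))) (hgen _ (Or.inl (Or.inr rfl)))
    (fun γ hγx hγy => hgen _ (Or.inr ⟨γ, hγx, hγy, rfl⟩))
  have htarget : Ideal.span {x ^ (a + 1)} ⊔ Ideal.span {x ^ a} * maximalIdeal R ^ 2 =
      Ideal.span {x ^ a} * (Ideal.span {x} ⊔ maximalIdeal R ^ 2) := by
    rw [pow_succ, ← Ideal.span_singleton_mul_span_singleton, span_singleton_mul_sup]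
  have h7 : D₀ ≤ Ideal.span {x} ⊔ maximalIdeal R ^ 2 := by
    rw [hD₀, Ideal.span_le]
    rintro _ ⟨v, hv, rfl⟩
    rw [SetLike.mem_coe, ← mul_mem_span_singleton_mul_iff hxa0, mul_comm (q v) (x ^ a), ← htarget]
    rcases hv with hv | hv
    · rw [Set.mem_singleton_iff.mp hv, hqx]; exact Hx
    · obtain ⟨γ, hγx, hγy, rfl⟩ := hv
      rw [hqN _ ⟨γ, hγx, hγy, rfl⟩]; exact Hγ γ hγx hγy
  exact ⟨D₀, B, h1, hqB.symm, h3, h45 x, h45 y, h6, h7⟩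

end Data

end Summit.ResolutionOfSingularities.ResolutionOfSingularities.Theorems.RadicialJung.CleanModels

end
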